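import Mathlib.Analysis.SpecialFunctions.Trigonometric.Chebyshev.Basic
import Mathlib.Analysis.SpecialFunctions.Complex.LogBounds
import Mathlib.NumberTheory.EulerProduct.DirichletLSeries
import Literature.NumberTheory.EllipticCurves.NewformPeterssonSizeSymmSquareProofs
import Literature.NumberTheory.EllipticCurves.RankinSymmSquareGL2Fields
import HarnessLib

/-!
# Local lemmas for the stub `stub_symmSqL_logEuler` of the crux skeleton `DefiniteXi.PeterssonLowerBound` (stmt-ABC-10870), line Sketch

Helper file (supports stmt-ABC-10870) for the log-Euler product of the continued imprimitive
symmetric square `L_f(s) = ζ(2s) L(|a|², s+1)/ζ(s)` (`symmSqL N f`, `RankinSymmSquareGL2Fields`) of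
a newform `f ∈ S₂(Γ₀(N))` on `Re s > 1`:

* Chebyshev values on `[-2, 2]` (`C_k(2cos θ) = 2cos kθ`, `|C_k(t)| ≤ 2`, `C_k² − 1 = 1 + 2cos 2kθ`);
* the geometric bound `Σ_k ‖c_k y^{k+1}‖ ≤ 6‖y‖` for `|c_k| ≤ 3`, `‖y‖ ≤ 1/2`;
* the logarithms of the local factors: at a good prime
  `Σ_{k≥1} (C_k(t)² − 1) y^k/k`, `t = 2cos θ`, has exponential `((1 − y)(1 − (t² − 2)y + y²))⁻¹`
  (`= ((1 − y)(1 − e^{2iθ}y)(1 − e^{−2iθ}y))⁻¹`, Mathlib's `hasSum_taylorSeries_neg_log`); at a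
  multiplicative prime `Σ_{k≥1} q^{-k} y^k/k = −log(1 − y/q)`;
* the Rankin–Selberg local factor at a good prime for a COMPLEX variable (port of the tree's real
  `IsNewform0.tsum_normSq_cuspCoeff_prime_pow_mul_eq`): the squares of a binary recurrence,
  `(Σ_e u_e² x^e)(1 − p x)(1 − (a² − 2p) x + p² x²) = 1 + p x`;
* the complex Euler product `L(|a|², s+1) = ∏'_p Σ_e a_{p^e}² p^{-e(s+1)}` for `Re s > 1`
  (`EulerProduct.eulerProduct_hasProd`, multiplicativity `IsNewform0.coeff_mul_of_coprime_holds`,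
  absolute convergence `summable_normSq_cuspCoeff_div_rpow`), the bad local factors
  (Atkin–Lehner), and the correction `∏_{p∣N}(1 + p^{-s})` as a `HasProd` over `Nat.Primes`.

## References

* D. Bump, *Automorphic forms and representations* (1997), §3.9. [Bump1997]
* R. A. Rankin, Proc. Cambridge Philos. Soc. 35 (1939). [Rankin1939]
* A. O. L. Atkin, J. Lehner, Math. Ann. 185 (1970), Thm. 3. [AtkinLehner1970]
-/

noncomputable section

open scoped Real Topology
open Set Filter Metric Complex CongruenceSubgroup
open Literature.NumberTheory.EllipticCurves.ModularForms

-- the summit-side namespace `Summit.ABC.ABC.Theorems` (summit = problem = `ABC`) is fixed by the tree layout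
set_option linter.dupNamespace false

namespace Summit.ABC.ABC.Theorems


/-! ### Chebyshev values on `[-2, 2]` -/

/-- For `|t| ≤ 2`, `t = 2 cos θ` with `θ = arccos (t/2)`. [folklore] -/
theorem symmSqLog_two_mul_cos_arccos_half {t : ℝ} (ht : |t| ≤ 2) : 2 * Real.cos (Real.arccos (t / 2)) = t := by
  have h := abs_le.mp ht
  rw [Real.cos_arccos (by linarith) (by linarith)]
  ring

/-- `C_n(2 cos θ)² − 1 = 1 + 2 cos (n · 2θ)` (`C_n(2cos θ) = 2cos nθ`). [folklore] -/
theorem symmSqLog_chebyshevC_sq_sub_one (θ : ℝ) (n : ℤ) :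
    ((Polynomial.Chebyshev.C ℝ n).eval (2 * Real.cos θ)) ^ 2 - 1 = 1 + 2 * Real.cos (n * (2 * θ)) := by
  rw [Polynomial.Chebyshev.C_two_mul_real_cos, show (n : ℝ) * (2 * θ) = 2 * (n * θ) by ring,
    Real.cos_two_mul]
  ring

/-- `|C_n(t)| ≤ 2` for `|t| ≤ 2`. [folklore] -/
theorem symmSqLog_abs_chebyshevC_eval_le {t : ℝ} (ht : |t| ≤ 2) (n : ℤ) :
    |(Polynomial.Chebyshev.C ℝ n).eval t| ≤ 2 := by
  rw [← symmSqLog_two_mul_cos_arccos_half ht, Polynomial.Chebyshev.C_two_mul_real_cos, abs_mul, abs_two]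
  have := Real.abs_cos_le_one (n * Real.arccos (t / 2))
  linarith

/-! ### A geometric bound -/

/-- Norm-summability of `Σ_k c_k y^{k+1}` for `|c_k| ≤ 3`, `‖y‖ ≤ 1/2`, with the bound `≤ 6‖y‖`.
[folklore] -/
theorem symmSqLog_summable_norm_mul_pow_succ {c : ℕ → ℝ} (hc : ∀ k, |c k| ≤ 3) {y : ℂ} (hy : ‖y‖ ≤ 1 / 2) :
    (Summable fun k : ℕ ↦ ‖(c k : ℂ) * y ^ (k + 1)‖) ∧
      ∑' k : ℕ, ‖(c k : ℂ) * y ^ (k + 1)‖ ≤ 6 * ‖y‖ := by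
  have hr0 : 0 ≤ ‖y‖ := norm_nonneg y
  have hr1 : ‖y‖ < 1 := by linarith
  have hg : HasSum (fun k : ℕ ↦ 3 * ‖y‖ * ‖y‖ ^ k) (3 * ‖y‖ * (1 - ‖y‖)⁻¹) :=
    (hasSum_geometric_of_lt_one hr0 hr1).mul_left _
  have hle : ∀ k, ‖(c k : ℂ) * y ^ (k + 1)‖ ≤ 3 * ‖y‖ * ‖y‖ ^ k := fun k ↦ by
    rw [norm_mul, Complex.norm_real, Real.norm_eq_abs, norm_pow, pow_succ]
    calc |c k| * (‖y‖ ^ k * ‖y‖) ≤ 3 * (‖y‖ ^ k * ‖y‖) :=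
          mul_le_mul_of_nonneg_right (hc k) (by positivity)
      _ = 3 * ‖y‖ * ‖y‖ ^ k := by ring
  have hsum : Summable fun k : ℕ ↦ ‖(c k : ℂ) * y ^ (k + 1)‖ :=
    Summable.of_nonneg_of_le (fun _ ↦ norm_nonneg _) hle hg.summable
  refine ⟨hsum, ?_⟩
  calc ∑' k : ℕ, ‖(c k : ℂ) * y ^ (k + 1)‖ ≤ ∑' k : ℕ, 3 * ‖y‖ * ‖y‖ ^ k :=
        hsum.tsum_le_tsum hle hg.summable
    _ = 3 * ‖y‖ * (1 - ‖y‖)⁻¹ := hg.tsum_eq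
    _ ≤ 6 * ‖y‖ := by
        rw [← div_eq_mul_inv, div_le_iff₀ (by linarith)]
        nlinarith

/-! ### Logarithms of the local factors -/

/-- `1 − z ≠ 0` and `1 + z ≠ 0` for `‖z‖ < 1`. [folklore] -/
theorem symmSqLog_one_sub_ne_zero {z : ℂ} (hz : ‖z‖ < 1) : 1 - z ≠ 0 ∧ 1 + z ≠ 0 := by
  constructor <;> intro h
  · rw [sub_eq_zero] at h
    rw [← h, norm_one] at hz
    exact lt_irrefl _ hz
  · have hz1 : z = -1 := by linear_combination h
    rw [hz1, norm_neg, norm_one] at hz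
    exact lt_irrefl _ hz

/-- The three logarithms at a good prime:
`Σ_{n≥1} (1 + 2cos nφ) yⁿ/n = −log(1−y) − log(1 − e^{iφ}y) − log(1 − e^{−iφ}y)` for `‖y‖ < 1`. [folklore] -/
theorem symmSqLog_hasSum_three_logs (φ : ℝ) {y : ℂ} (hy : ‖y‖ < 1) :
    HasSum (fun n : ℕ ↦ (1 + 2 * Complex.cos (n * φ)) * y ^ n / n)
      (-Complex.log (1 - y) + -Complex.log (1 - Complex.exp (φ * I) * y) +
        -Complex.log (1 - Complex.exp (-(φ * I)) * y)) := by
  have hu : ‖Complex.exp (φ * I)‖ = 1 := Complex.norm_exp_ofReal_mul_I φ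
  have hu' : ‖Complex.exp (-((φ : ℂ) * I))‖ = 1 := by
    rw [show -((φ : ℂ) * I) = ((-φ : ℝ) : ℂ) * I by push_cast; ring]
    exact Complex.norm_exp_ofReal_mul_I _
  have h1 := Complex.hasSum_taylorSeries_neg_log hy
  have h2 := Complex.hasSum_taylorSeries_neg_log (z := Complex.exp (φ * I) * y)
    (by rw [norm_mul, hu, one_mul]; exact hy)
  have h3 := Complex.hasSum_taylorSeries_neg_log (z := Complex.exp (-(φ * I)) * y)
    (by rw [norm_mul, hu', one_mul]; exact hy)
  convert (h1.add h2).add h3 using 1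
  funext n
  have hc : 2 * Complex.cos (n * φ) = Complex.exp (φ * I) ^ n + Complex.exp (-(φ * I)) ^ n := by
    rw [Complex.two_cos, ← Complex.exp_nat_mul, ← Complex.exp_nat_mul]
    congr 2 <;> ring
  rw [hc, mul_pow, mul_pow]
  ring

/-- The exponential of the three logarithms:
`((1 − y)(1 − e^{iφ}y)(1 − e^{−iφ}y))⁻¹ = ((1 − y)(1 − 2cos φ · y + y²))⁻¹`. [folklore] -/
theorem symmSqLog_exp_three_logs (φ : ℝ) {y : ℂ} (hy : ‖y‖ < 1) :
    Complex.exp (-Complex.log (1 - y) + -Complex.log (1 - Complex.exp (φ * I) * y) +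
        -Complex.log (1 - Complex.exp (-(φ * I)) * y)) =
      ((1 - y) * (1 - 2 * Complex.cos φ * y + y ^ 2))⁻¹ := by
  have hu : ‖Complex.exp (φ * I)‖ = 1 := Complex.norm_exp_ofReal_mul_I φ
  have hu' : ‖Complex.exp (-((φ : ℂ) * I))‖ = 1 := by
    rw [show -((φ : ℂ) * I) = ((-φ : ℝ) : ℂ) * I by push_cast; ring]
    exact Complex.norm_exp_ofReal_mul_I _
  have h1 := (symmSqLog_one_sub_ne_zero hy).1
  have h2 := (symmSqLog_one_sub_ne_zero (z := Complex.exp (φ * I) * y)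
    (by rw [norm_mul, hu, one_mul]; exact hy)).1
  have h3 := (symmSqLog_one_sub_ne_zero (z := Complex.exp (-(φ * I)) * y)
    (by rw [norm_mul, hu', one_mul]; exact hy)).1
  have huu : Complex.exp (φ * I) * Complex.exp (-(φ * I)) = 1 := by
    rw [← Complex.exp_add, add_neg_cancel, Complex.exp_zero]
  have hcos : Complex.exp (φ * I) + Complex.exp (-(φ * I)) = 2 * Complex.cos φ := by
    rw [Complex.two_cos, neg_mul]
  have hq : (1 - Complex.exp (φ * I) * y) * (1 - Complex.exp (-(φ * I)) * y) =
      1 - 2 * Complex.cos φ * y + y ^ 2 := by linear_combination (-y) * hcos + y ^ 2 * huu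
  rw [Complex.exp_add, Complex.exp_add, Complex.exp_neg, Complex.exp_neg, Complex.exp_neg,
    Complex.exp_log h1, Complex.exp_log h2, Complex.exp_log h3, ← hq, ← mul_inv, ← mul_inv, mul_assoc]

/-- **Good prime.** For `|t| ≤ 2` and `‖y‖ < 1` the series `Σ_{k≥1} (C_k(t)² − 1) y^k/k` converges
and its exponential is `((1 − y)(1 − (t² − 2) y + y²))⁻¹` (`t = 2cos θ`: the logarithm of
`((1 − y)(1 − e^{2iθ}y)(1 − e^{−2iθ}y))⁻¹`). [cite: Bump1997, §3.9] -/
theorem symmSqLog_exists_hasSum_good {t : ℝ} (ht : |t| ≤ 2) {y : ℂ} (hy : ‖y‖ < 1) :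
    ∃ Λ : ℂ, HasSum (fun k : ℕ ↦
        (((((Polynomial.Chebyshev.C ℝ (k + 1)).eval t) ^ 2 - 1) / (k + 1) : ℝ) : ℂ) * y ^ (k + 1)) Λ ∧
      Complex.exp Λ = ((1 - y) * (1 - ((t ^ 2 - 2 : ℝ) : ℂ) * y + y ^ 2))⁻¹ := by
  obtain ⟨θ, rfl⟩ : ∃ θ : ℝ, t = 2 * Real.cos θ := ⟨_, (symmSqLog_two_mul_cos_arccos_half ht).symm⟩
  have hcos : (((2 * Real.cos θ) ^ 2 - 2 : ℝ) : ℂ) = 2 * Complex.cos ((2 * θ : ℝ) : ℂ) := by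
    rw [show (2 * Real.cos θ) ^ 2 - 2 = 2 * Real.cos (2 * θ) by rw [Real.cos_two_mul]; ring]
    push_cast
    ring_nf
  rw [hcos]
  refine ⟨_, ?_, symmSqLog_exp_three_logs (2 * θ) hy⟩
  have h := symmSqLog_hasSum_three_logs (2 * θ) hy
  rw [← hasSum_nat_add_iff' 1] at h
  simp only [Finset.sum_range_one, Nat.cast_zero, div_zero, sub_zero] at h
  refine h.congr_fun fun k ↦ ?_
  rw [symmSqLog_chebyshevC_sq_sub_one]
  push_cast
  ring

/-- **Multiplicative prime.** For real `q ≥ 1` and `‖y‖ < 1` the series `Σ_{k≥1} q^{-k} y^k/k`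
converges and its exponential is `(1 − y/q)⁻¹`. [folklore] -/
theorem symmSqLog_exists_hasSum_mult {q : ℝ} (hq : 1 ≤ q) {y : ℂ} (hy : ‖y‖ < 1) :
    ∃ Λ : ℂ, HasSum (fun k : ℕ ↦ ((((q ^ (k + 1))⁻¹ / (k + 1) : ℝ) : ℂ) * y ^ (k + 1))) Λ ∧
      Complex.exp Λ = (1 - y / q)⁻¹ := by
  have hyq : ‖y / q‖ < 1 := by
    rw [norm_div, Complex.norm_real, Real.norm_of_nonneg (by linarith)]
    exact (div_le_self (norm_nonneg _) hq).trans_lt hy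
  refine ⟨-Complex.log (1 - y / q), ?_, by
    rw [Complex.exp_neg, Complex.exp_log (symmSqLog_one_sub_ne_zero hyq).1]⟩
  have h := Complex.hasSum_taylorSeries_neg_log hyq
  rw [← hasSum_nat_add_iff' 1] at h
  simp only [Finset.sum_range_one, Nat.cast_zero, div_zero, sub_zero, pow_zero] at h
  refine h.congr_fun fun k ↦ ?_
  push_cast
  rw [div_pow]
  ring

/-! ### The Rankin–Selberg local factor at a good prime, complex variable -/

/-- **Squares of a binary recurrence.** If `u₀ = 1`, `u_{e+2} = a u_{e+1} − p u_e` and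
`Σ_e u_e² x^e` converges, then `(Σ_e u_e² x^e)·(1 − p x)(1 − (a² − 2p) x + p² x²) = 1 + p x`
(the squares satisfy the order-three recursion with roots `α², αβ, β²`). [cite: Bump1997, §3.9] -/
theorem symmSqLog_tsum_sq_mul_pow_mul_cubic {u : ℕ → ℂ} {a p x : ℂ} (hu0 : u 0 = 1) (hu1 : u 1 = a)
    (hrec : ∀ e, u (e + 2) = a * u (e + 1) - p * u e) (hs : Summable fun e : ℕ ↦ u e ^ 2 * x ^ e) :
    (∑' e : ℕ, u e ^ 2 * x ^ e) * ((1 - p * x) * (1 - (a ^ 2 - 2 * p) * x + p ^ 2 * x ^ 2)) =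
      1 + p * x := by
  have hu2 : u 2 = a ^ 2 - p := by
    have h := hrec 0
    rw [zero_add, zero_add, hu0, hu1, mul_one] at h
    rw [h]; ring
  have hsq : ∀ e, u (e + 3) ^ 2 =
      (a ^ 2 - p) * u (e + 2) ^ 2 - (p * a ^ 2 - p ^ 2) * u (e + 1) ^ 2 + p ^ 3 * u e ^ 2 := by
    intro e
    have h2 : u (e + 2) = a * u (e + 1) - p * u e := hrec e
    have h3 : u (e + 3) = a * u (e + 2) - p * u (e + 1) := hrec (e + 1)
    rw [h3, h2]; ring
  obtain ⟨S, hS⟩ : ∃ S, HasSum (fun e : ℕ ↦ u e ^ 2 * x ^ e) S := ⟨_, hs.hasSum⟩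
  rw [hS.tsum_eq]
  have h1 : HasSum (fun e : ℕ ↦ u (e + 1) ^ 2 * x ^ (e + 1))
      (S - ∑ i ∈ Finset.range 1, u i ^ 2 * x ^ i) := (hasSum_nat_add_iff' 1).mpr hS
  have h2 : HasSum (fun e : ℕ ↦ u (e + 2) ^ 2 * x ^ (e + 2))
      (S - ∑ i ∈ Finset.range 2, u i ^ 2 * x ^ i) := (hasSum_nat_add_iff' 2).mpr hS
  have h3 : HasSum (fun e : ℕ ↦ u (e + 3) ^ 2 * x ^ (e + 3))
      (S - ∑ i ∈ Finset.range 3, u i ^ 2 * x ^ i) := (hasSum_nat_add_iff' 3).mpr hS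
  have hfun : (fun e : ℕ ↦ u (e + 3) ^ 2 * x ^ (e + 3)) = fun e : ℕ ↦
      (a ^ 2 - p) * x * (u (e + 2) ^ 2 * x ^ (e + 2)) -
        (p * a ^ 2 - p ^ 2) * x ^ 2 * (u (e + 1) ^ 2 * x ^ (e + 1)) +
        p ^ 3 * x ^ 3 * (u e ^ 2 * x ^ e) := by
    funext e; rw [hsq e]; ring
  have h3' : HasSum (fun e : ℕ ↦ u (e + 3) ^ 2 * x ^ (e + 3))
      ((a ^ 2 - p) * x * (S - ∑ i ∈ Finset.range 2, u i ^ 2 * x ^ i) -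
        (p * a ^ 2 - p ^ 2) * x ^ 2 * (S - ∑ i ∈ Finset.range 1, u i ^ 2 * x ^ i) +
        p ^ 3 * x ^ 3 * S) := by
    rw [hfun]
    exact ((h2.mul_left _).sub (h1.mul_left _)).add (hS.mul_left _)
  have heq := h3.unique h3'
  simp only [Finset.sum_range_succ, Finset.sum_range_zero, zero_add, pow_zero, pow_one, hu0, hu1,
    hu2, one_pow, one_mul] at heq
  linear_combination heq

/-! ### Small utilities on Euler products -/

/-- A product over the primes dividing `N ≠ 0`, indexed by a finset of `Nat.Primes`, is the product
over `N.primeFactors` (complex-valued version of `prod_finset_primes_eq_prod_primeFactors`). [folklore] -/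
theorem symmSqLog_prod_finset_primes_eq {N : ℕ} (hN : N ≠ 0) {S : Finset Nat.Primes}
    (hS : ∀ p : Nat.Primes, p ∈ S ↔ (p : ℕ) ∣ N) (φ : ℕ → ℂ) :
    ∏ p ∈ S, φ p = ∏ p ∈ N.primeFactors, φ p := by
  refine Finset.prod_nbij (fun p : Nat.Primes ↦ (p : ℕ)) (fun p hp ↦ ?_)
    (Nat.Primes.coe_nat_injective.injOn) (fun q hq ↦ ?_) (fun p _ ↦ rfl)
  · exact Nat.mem_primeFactors.mpr ⟨p.2, (hS p).mp hp, hN⟩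
  · have hq' := Nat.mem_primeFactors.mp hq
    exact ⟨⟨q, hq'.1⟩, (hS ⟨q, hq'.1⟩).mpr hq'.2.1, rfl⟩

/-- The correction factor as an Euler product: `∏'_p (p ∣ N ? 1 + p^{-s} : 1) = ∏_{p∣N}(1 + p^{-s})`.
[folklore] -/
theorem symmSqLog_hasProd_corr {N : ℕ} (hN : N ≠ 0) (s : ℂ) :
    HasProd (fun p : Nat.Primes ↦ if (p : ℕ) ∣ N then 1 + (p : ℂ) ^ (-s) else 1)
      (∏ p ∈ N.primeFactors, (1 + (p : ℂ) ^ (-s))) := by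
  obtain ⟨S, hS⟩ := exists_finset_primes_mem_iff_dvd hN
  rw [← symmSqLog_prod_finset_primes_eq hN hS (fun q : ℕ ↦ 1 + (q : ℂ) ^ (-s)),
    ← Finset.prod_congr rfl (fun p hp ↦ if_pos ((hS p).mp hp))]
  exact hasProd_prod_of_ne_finset_one fun p hp ↦ by rw [if_neg (fun h ↦ hp ((hS p).mpr h))]

/-! ### Newform pieces -/

variable {N : ℕ} [NeZero N]

/-- For a newform, `((‖aₙ‖² : ℝ) : ℂ) = aₙ²` (the coefficients are real). [folklore] -/
theorem symmSqLog_ofReal_norm_sq_cuspCoeff {k : ℤ} {f : CuspForm (Gamma0 N) k} (hf : IsNewform0 f) (n : ℕ) :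
    (((‖cuspCoeff f n‖ ^ 2 : ℝ)) : ℂ) = cuspCoeff f n ^ 2 := by
  rw [hf.norm_cuspCoeff_sq n]
  conv_rhs => rw [hf.cuspCoeff_eq_ofReal_re n]
  push_cast
  ring

omit [NeZero N] in
/-- The coefficient bound `|b| ≤ 3` for the log-coefficients (`|C_k(t)| ≤ 2` under Ramanujan at the
good primes; `p^{-k}/k ≤ 1` at `p ∥ N`; `0` at `p² ∣ N`). [folklore] -/
theorem symmSqLog_abs_coeff_le {f : CuspForm (Gamma0 N) 2}
    (hR : ∀ p : ℕ, p.Prime → ¬ p ∣ N → |(cuspCoeff f p).re| ≤ 2 * Real.sqrt p) {p : ℕ} (hp : p.Prime)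
    (k : ℕ) :
    |(if ¬ p ∣ N then
        (((Polynomial.Chebyshev.C ℝ (k + 1)).eval ((cuspCoeff f p).re / Real.sqrt p)) ^ 2 - 1) / (k + 1)
      else if ¬ p ^ 2 ∣ N then ((p : ℝ) ^ (k + 1))⁻¹ / (k + 1) else 0 : ℝ)| ≤ 3 := by
  have hk : (1 : ℝ) ≤ k + 1 := by simp
  have hk0 : (0 : ℝ) < k + 1 := by linarith
  by_cases hpN : p ∣ N
  · rw [if_neg (not_not_intro hpN)]
    by_cases hp2 : p ^ 2 ∣ N
    · rw [if_neg (not_not_intro hp2)]; simp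
    · rw [if_pos hp2, abs_of_nonneg (by positivity)]
      calc ((p : ℝ) ^ (k + 1))⁻¹ / (k + 1) ≤ ((p : ℝ) ^ (k + 1))⁻¹ := div_le_self (by positivity) hk
        _ ≤ 1 := inv_le_one_of_one_le₀ (one_le_pow₀ (by exact_mod_cast hp.one_lt.le))
        _ ≤ 3 := by norm_num
  · rw [if_pos hpN]
    have hsp : 0 < Real.sqrt p := Real.sqrt_pos.mpr (by exact_mod_cast hp.pos)
    have ht : |(cuspCoeff f p).re / Real.sqrt p| ≤ 2 := by
      rw [abs_div, abs_of_pos hsp, div_le_iff₀ hsp]; exact hR p hp hpN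
    have hP := abs_le.mp (symmSqLog_abs_chebyshevC_eval_le ht (k + 1))
    rw [abs_div, abs_of_pos hk0]
    calc _ ≤ |((Polynomial.Chebyshev.C ℝ (k + 1)).eval ((cuspCoeff f p).re / Real.sqrt p)) ^ 2 - 1| :=
          div_le_self (abs_nonneg _) hk
      _ ≤ 3 := by rw [abs_le]; constructor <;> nlinarith

/-- **Euler product of `L(|a|², s+1)` for complex `Re s > 1`**: for a newform `f ∈ S₂(Γ₀(N))`,
`L(|a|², s+1) = ∏'_p Σ_e a_{p^e}² (p^{-(s+1)})^e` (multiplicativity, Atkin–Lehner 1970 Thm. 3, and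
absolute convergence, Rankin 1939), with the local series summable. [cite: Rankin1939, convergence of Σ|aₙ|²n^{-s} for Re s > k] -/
theorem symmSqLog_hasProd_LSeries_normSq {f : CuspForm (Gamma0 N) 2} (hf : IsNewform0 f) {s : ℂ} (hs : 1 < s.re) :
    HasProd (fun p : Nat.Primes ↦ ∑' e : ℕ, cuspCoeff f ((p : ℕ) ^ e) ^ 2 * (((p : ℕ) : ℂ) ^ (-(s + 1))) ^ e)
        (LSeries (fun n ↦ ((‖cuspCoeff f n‖ ^ 2 : ℝ) : ℂ)) (s + 1)) ∧
      ∀ {p : ℕ}, p.Prime → Summable fun e : ℕ ↦ cuspCoeff f (p ^ e) ^ 2 * ((p : ℂ) ^ (-(s + 1))) ^ e := by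
  set g : ℕ → ℂ := fun n ↦ ((‖cuspCoeff f n‖ ^ 2 : ℝ) : ℂ) with hg
  have hs1 : s + 1 ≠ 0 := fun h ↦ by
    have := congrArg Complex.re h
    simp only [add_re, one_re, zero_re] at this
    linarith
  have hF : ∀ n : ℕ, LSeries.term g (s + 1) n = cuspCoeff f n ^ 2 * (n : ℂ) ^ (-(s + 1)) := fun n ↦ by
    rw [LSeries.term_of_ne_zero' hs1, div_eq_mul_inv, ← Complex.cpow_neg, hg]
    simp only
    rw [symmSqLog_ofReal_norm_sq_cuspCoeff hf]
  have hFpow : ∀ p e : ℕ, LSeries.term g (s + 1) (p ^ e) =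
      cuspCoeff f (p ^ e) ^ 2 * ((p : ℂ) ^ (-(s + 1))) ^ e := fun p e ↦ by
    rw [hF, Nat.cast_pow, ← Complex.natCast_cpow_natCast_mul, Complex.cpow_nat_mul]
  have hsum : Summable fun n : ℕ ↦ ‖LSeries.term g (s + 1) n‖ := by
    have hw : 2 < (s + 1).re := by simp only [add_re, one_re]; linarith
    refine (summable_normSq_cuspCoeff_div_rpow f hw).congr fun n ↦ ?_
    rw [LSeries.norm_term_eq]
    rcases Nat.eq_zero_or_pos n with rfl | hn
    · simp [Real.zero_rpow (by linarith : s.re + 1 ≠ 0)]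
    · rw [if_neg hn.ne', hg]
      simp only
      rw [Complex.norm_real, Real.norm_of_nonneg (sq_nonneg _)]
  have h1 : LSeries.term g (s + 1) 1 = 1 := by
    rw [hF, show cuspCoeff f 1 = 1 from hf.2.2, Nat.cast_one, Complex.one_cpow]; ring
  have hmul : ∀ {m n : ℕ}, m.Coprime n →
      LSeries.term g (s + 1) (m * n) = LSeries.term g (s + 1) m * LSeries.term g (s + 1) n := by
    intro m n hmn
    have h : cuspCoeff f (m * n) = cuspCoeff f m * cuspCoeff f n :=
      IsNewform0.coeff_mul_of_coprime_holds hf hmn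
    rw [hF, hF, hF, h, Nat.cast_mul, Complex.natCast_mul_natCast_cpow]
    ring
  have hE := EulerProduct.eulerProduct_hasProd (f := fun n ↦ LSeries.term g (s + 1) n) h1 hmul hsum
    (LSeries.term_zero _ _)
  refine ⟨hE.congr_fun fun p ↦ tsum_congr fun e ↦ (hFpow p e).symm, fun {p} hp ↦ ?_⟩
  refine (hsum.of_norm.comp_injective (Nat.pow_right_injective hp.two_le)).congr fun e ↦ ?_
  simp only [Function.comp_apply]
  exact hFpow p e

/-- `p² ∣ N`: `Σ_e a_{p^e}² x^e = 1` (`a_{p^e} = 0`, `e ≥ 1`). [cite: AtkinLehner1970, Thm. 3] -/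
theorem symmSqLog_tsum_sq_cuspCoeff_of_sq_dvd {f : CuspForm (Gamma0 N) 2} (hf : IsNewform0 f) {p : ℕ}
    (hp : p.Prime) (hp2 : p ^ 2 ∣ N) (x : ℂ) : ∑' e : ℕ, cuspCoeff f (p ^ e) ^ 2 * x ^ e = 1 := by
  have h0 : ∀ e : ℕ, cuspCoeff f (p ^ (e + 1)) ^ 2 * x ^ (e + 1) = 0 := fun e ↦ by
    rw [hf.cuspCoeff_prime_pow_eq_zero_of_sq_dvd hp hp2 e]; ring
  rw [tsum_eq_zero_add' (by simp_rw [h0]; exact summable_zero)]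
  simp_rw [h0, tsum_zero, add_zero, pow_zero, show cuspCoeff f 1 = 1 from hf.2.2]
  ring

/-- `p ∥ N`: `Σ_e a_{p^e}² x^e = (1 − x)⁻¹` for `‖x‖ < 1` (`a_{p^e}² = 1`). [cite: AtkinLehner1970, Thm. 3] -/
theorem symmSqLog_tsum_sq_cuspCoeff_of_dvd {f : CuspForm (Gamma0 N) 2} (hf : IsNewform0 f) {p : ℕ}
    (hp : p.Prime) (hpN : p ∣ N) (hp2 : ¬ p ^ 2 ∣ N) {x : ℂ} (hx : ‖x‖ < 1) :
    ∑' e : ℕ, cuspCoeff f (p ^ e) ^ 2 * x ^ e = (1 - x)⁻¹ := by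
  have h1 : ∀ e : ℕ, cuspCoeff f (p ^ e) ^ 2 = 1 := fun e ↦ by
    rw [hf.cuspCoeff_prime_pow_of_dvd hp hpN e, ← pow_mul, mul_comm, pow_mul,
      hf.cuspCoeff_sq_eq_one_of_dvd_of_not_sq_dvd hp hpN hp2, one_pow]
  simp_rw [h1, one_mul]
  exact (hasSum_geometric_of_norm_lt_one hx).tsum_eq

end Summit.ABC.ABC.Theorems

end
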